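import Summits.CriticalPhenomena.PercolationContinuityZ3.Theorems.SahiIsingHolleyNonlocal

/-!
# The cross box condition for Ising measures with ordered boundary conditions; it is closed under local limits;
# hence `μ⁻ ≤ μ⁺` in infinite volume on every cylinder (local) increasing event and functional — density-free Holley

Support file of the Sahi cell (`prim-sahi`, typer seat, generation 15; `--supports stmt-CriticalPhenomena-4575`).
Theorems only (no definitions, no named facts, no sorries).  The two-measure companion of generation 13's
`SahiIsingBoxTP2.lean` (finite-volume Ising measures and their local limits are box-TP₂):

* `glue_inf_fixed`, `glue_sup_fixed`, `isingWeight_cross_condition` — for `β ≥ 0` and boundary conditions `η ≤ η'`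
  the Ising weights satisfy HOLLEY'S CONDITION `w_η(τ) w_{η'}(τ') ≤ w_η(τ ∧ τ') w_{η'}(τ ∨ τ')` (the Hamiltonian with
  a fixed boundary condition is one supermodular function of the full configuration, and
  `glue τ η ∧ glue τ' η' = glue (τ ∧ τ') η`, `glue τ η ∨ glue τ' η' = glue (τ ∨ τ') η'`).
* `crossBox_isingMeasure_fixed` — hence **the cross box condition
  `μ_η[a,b] μ_{η'}[a',b'] ≤ μ_η[a ∧ a', b ∧ b'] μ_{η'}[a ∨ a', b ∨ b']`** for the finite-volume Ising measures
  `μ^η_{Λ;β,h}, μ^{η'}_{Λ;β,h}` on `{−1,+1}^V` (four functions theorem on `{−1,+1}^Λ`).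
* `crossBox_of_tendsto_local₂` — the cross box condition passes to local limits of two sequences (face boxes over an
  exhaustion, continuity from above); `crossBox_of_tendsto_isingMeasure_fixed`, `integral_le_of_tendsto_isingMeasure_fixed`
  — local limits of Ising measures with boundary conditions `η_L ≤ η'_L` (any volumes, any graph) are stochastically
  ordered for ALL bounded measurable increasing functionals.
* `isingWeight_cross_condition_field`, `crossBox_isingMeasure_field` — the same for two FIELDS `h ≤ h'` (same b.c.);
  `crossBox_plus_field`, **`plusState_mono_field`** — the plus state is stochastically increasing in the field, for
  all bounded measurable increasing functionals of the infinite configuration.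
* `crossBox_minus_plus` — **the infinite-volume minus and plus states of `ℤ^d` (`β ≥ 0`, any `h`) satisfy the cross
  box condition**; hence (`SahiIsingHolleyNonlocal.holley_of_crossBox_spin`) **`minusState_le_plusState`:
  `∫ f dμ⁻ ≤ ∫ f dμ⁺` for EVERY bounded measurable increasing functional of the infinite configuration**,
  `minusState_le_plusState_upperSet` (every measurable increasing event), and the local forms
  `minusState_le_plusState_local/_upperSet_local` — for ANY probability measures with the minus / plus correlations
  (FV17 Lemma 3.23 is the finite-volume, local form; tree `isingExpect_minus_le_fixed`).

No sorries, no new axioms.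
-/

noncomputable section

namespace Summit.CriticalPhenomena.PercolationContinuityZ3.Theorems.SahiBoxTP2

open MeasureTheory Set Filter Topology Function
open Literature.Probability.LatticeModels
open scoped ENNReal

/-! ### Holley's condition for the Ising weights with ordered boundary conditions -/

section Weights

variable {V : Type*} [DecidableEq V]

/-- `glue τ η ∧ glue τ' η' = glue (τ ∧ τ') η` for `η ≤ η'`. [folklore] -/
theorem glue_inf_fixed (Λ : Finset V) {η η' : SpinConfig V} (hη : η ≤ η') (τ τ' : Λ → ℤˣ) :
    glue Λ τ (.fixed η) ⊓ glue Λ τ' (.fixed η') = glue Λ (τ ⊓ τ') (.fixed η) := by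
  funext x
  by_cases hx : x ∈ Λ
  · simp [hx]
  · simpa [hx] using hη x

/-- `glue τ η ∨ glue τ' η' = glue (τ ∨ τ') η'` for `η ≤ η'`. [folklore] -/
theorem glue_sup_fixed (Λ : Finset V) {η η' : SpinConfig V} (hη : η ≤ η') (τ τ' : Λ → ℤˣ) :
    glue Λ τ (.fixed η) ⊔ glue Λ τ' (.fixed η') = glue Λ (τ ⊔ τ') (.fixed η') := by
  funext x
  by_cases hx : x ∈ Λ
  · simp [hx]
  · simpa [hx] using hη x

variable (G : SimpleGraph V) [G.LocallyFinite]

/-- The Hamiltonian with a fixed boundary condition, as a function of the full configuration, does not depend on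
which configuration is fixed (same interaction edges). [folklore] -/
theorem isingHamiltonian_fixed_eq (Λ : Finset V) (h : ℝ) (η η' : SpinConfig V) :
    isingHamiltonian G Λ h (.fixed η) = isingHamiltonian G Λ h (.fixed η') := rfl

/-- **Holley's condition for the Ising weights with boundary conditions `η ≤ η'`** (`β ≥ 0`):
`w_η(τ) w_{η'}(τ') ≤ w_η(τ ∧ τ') w_{η'}(τ ∨ τ')`. [this work] -/
theorem isingWeight_cross_condition (Λ : Finset V) {β : ℝ} (hβ : 0 ≤ β) (h : ℝ) {η η' : SpinConfig V}
    (hη : η ≤ η') (τ τ' : Λ → ℤˣ) :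
    isingWeight G Λ β h (.fixed η) τ * isingWeight G Λ β h (.fixed η') τ' ≤
      isingWeight G Λ β h (.fixed η) (τ ⊓ τ') * isingWeight G Λ β h (.fixed η') (τ ⊔ τ') := by
  simp only [isingWeight, ← Real.exp_add]
  refine Real.exp_le_exp.2 ?_
  have hsm := neg_isingHamiltonian_supermodular G Λ h (.fixed η) (glue Λ τ (.fixed η)) (glue Λ τ' (.fixed η'))
  rw [glue_inf_fixed Λ hη, glue_sup_fixed Λ hη] at hsm
  rw [isingHamiltonian_fixed_eq G Λ h η' η]
  have := mul_le_mul_of_nonneg_left hsm hβ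
  linarith

open scoped FinsetFamily in
/-- **The cross box condition for finite-volume Ising measures with ordered boundary conditions** (`β ≥ 0`, any `h`,
any countable locally finite graph): `μ_η[a,b] μ_{η'}[a',b'] ≤ μ_η[a ∧ a', b ∧ b'] μ_{η'}[a ∨ a', b ∨ b']`.
[this work] -/
theorem crossBox_isingMeasure_fixed [Countable V] (Λ : Finset V) {β : ℝ} (hβ : 0 ≤ β) (h : ℝ)
    {η η' : SpinConfig V} (hη : η ≤ η') (a b a' b' : V → ℤˣ) :
    isingMeasure G Λ β h (.fixed η) (Icc a b) * isingMeasure G Λ β h (.fixed η') (Icc a' b') ≤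
      isingMeasure G Λ β h (.fixed η) (Icc (a ⊓ a') (b ⊓ b')) *
        isingMeasure G Λ β h (.fixed η') (Icc (a ⊔ a') (b ⊔ b')) := by
  classical
  set w₁ : (Λ → ℤˣ) → ℝ := isingWeight G Λ β h (.fixed η) with hw₁
  set w₂ : (Λ → ℤˣ) → ℝ := isingWeight G Λ β h (.fixed η') with hw₂
  set Z₁ : ℝ := isingPartitionFunction G Λ β h (.fixed η) with hZ₁
  set Z₂ : ℝ := isingPartitionFunction G Λ β h (.fixed η') with hZ₂
  have hZ₁pos : 0 < Z₁ := isingPartitionFunction_pos G Λ β h _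
  have hZ₂pos : 0 < Z₂ := isingPartitionFunction_pos G Λ β h _
  have hw₁0 : 0 ≤ w₁ := fun τ => (isingWeight_pos G Λ β h _ τ).le
  have hw₂0 : 0 ≤ w₂ := fun τ => (isingWeight_pos G Λ β h _ τ).le
  set S₁ : (V → ℤˣ) → (V → ℤˣ) → Finset (Λ → ℤˣ) :=
    fun p q => Finset.univ.filter fun τ => glue Λ τ (.fixed η) ∈ Icc p q with hS₁
  set S₂ : (V → ℤˣ) → (V → ℤˣ) → Finset (Λ → ℤˣ) :=
    fun p q => Finset.univ.filter fun τ => glue Λ τ (.fixed η') ∈ Icc p q with hS₂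
  have happ₁ : ∀ p q : V → ℤˣ, isingMeasure G Λ β h (.fixed η) (Icc p q) =
      ENNReal.ofReal ((∑ τ ∈ S₁ p q, w₁ τ) / Z₁) := fun p q => by
    rw [isingMeasure_apply_of_measurableSet G Λ β h _ (measurableSet_Icc_spinConfig p q)]
  have happ₂ : ∀ p q : V → ℤˣ, isingMeasure G Λ β h (.fixed η') (Icc p q) =
      ENNReal.ofReal ((∑ τ ∈ S₂ p q, w₂ τ) / Z₂) := fun p q => by
    rw [isingMeasure_apply_of_measurableSet G Λ β h _ (measurableSet_Icc_spinConfig p q)]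
  have hs₁ : ∀ p q : V → ℤˣ, 0 ≤ (∑ τ ∈ S₁ p q, w₁ τ) / Z₁ := fun p q =>
    div_nonneg (Finset.sum_nonneg fun τ _ => hw₁0 τ) hZ₁pos.le
  have hs₂ : ∀ p q : V → ℤˣ, 0 ≤ (∑ τ ∈ S₂ p q, w₂ τ) / Z₂ := fun p q =>
    div_nonneg (Finset.sum_nonneg fun τ _ => hw₂0 τ) hZ₂pos.le
  rw [happ₁, happ₂, happ₁, happ₂, ← ENNReal.ofReal_mul (hs₁ _ _), ← ENNReal.ofReal_mul (hs₁ _ _)]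
  refine ENNReal.ofReal_le_ofReal ?_
  rw [div_mul_div_comm, div_mul_div_comm]
  refine div_le_div_of_nonneg_right ?_ (mul_pos hZ₁pos hZ₂pos).le
  have h4 := four_functions_theorem w₁ w₂ w₁ w₂ hw₁0 hw₂0 hw₁0 hw₂0
    (fun τ τ' => isingWeight_cross_condition G Λ hβ h hη τ τ') (S₁ a b) (S₂ a' b')
  have hinfs : S₁ a b ⊼ S₂ a' b' ⊆ S₁ (a ⊓ a') (b ⊓ b') := by
    intro c hc
    rw [Finset.mem_infs] at hc
    obtain ⟨τ, hτ, τ', hτ', rfl⟩ := hc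
    simp only [hS₁, hS₂, Finset.mem_filter, Finset.mem_univ, true_and, mem_Icc] at hτ hτ' ⊢
    rw [← glue_inf_fixed Λ hη]
    exact ⟨le_inf (inf_le_left.trans hτ.1) (inf_le_right.trans hτ'.1), inf_le_inf hτ.2 hτ'.2⟩
  have hsups : S₁ a b ⊻ S₂ a' b' ⊆ S₂ (a ⊔ a') (b ⊔ b') := by
    intro c hc
    rw [Finset.mem_sups] at hc
    obtain ⟨τ, hτ, τ', hτ', rfl⟩ := hc
    simp only [hS₁, hS₂, Finset.mem_filter, Finset.mem_univ, true_and, mem_Icc] at hτ hτ' ⊢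
    rw [← glue_sup_fixed Λ hη]
    exact ⟨sup_le_sup hτ.1 hτ'.1, sup_le (hτ.2.trans le_sup_left) (hτ'.2.trans le_sup_right)⟩
  calc (∑ τ ∈ S₁ a b, w₁ τ) * ∑ τ ∈ S₂ a' b', w₂ τ
      ≤ (∑ τ ∈ S₁ a b ⊼ S₂ a' b', w₁ τ) * ∑ τ ∈ S₁ a b ⊻ S₂ a' b', w₂ τ := h4
    _ ≤ (∑ τ ∈ S₁ (a ⊓ a') (b ⊓ b'), w₁ τ) * ∑ τ ∈ S₂ (a ⊔ a') (b ⊔ b'), w₂ τ :=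
        mul_le_mul (Finset.sum_le_sum_of_subset_of_nonneg hinfs fun τ _ _ => hw₁0 τ)
          (Finset.sum_le_sum_of_subset_of_nonneg hsups fun τ _ _ => hw₂0 τ)
          (Finset.sum_nonneg fun τ _ => hw₂0 τ) (Finset.sum_nonneg fun τ _ => hw₁0 τ)

/-- **Holley's condition for the Ising weights at fields `h ≤ h'`** (same boundary condition, `β ≥ 0`):
`w_h(τ) w_{h'}(τ') ≤ w_h(τ ∧ τ') w_{h'}(τ ∨ τ')`. [this work] -/
theorem isingWeight_cross_condition_field (Λ : Finset V) {β : ℝ} (hβ : 0 ≤ β) {h h' : ℝ} (hh : h ≤ h')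
    (bc : BoundaryCondition V) (τ τ' : Λ → ℤˣ) :
    isingWeight G Λ β h bc τ * isingWeight G Λ β h' bc τ' ≤
      isingWeight G Λ β h bc (τ ⊓ τ') * isingWeight G Λ β h' bc (τ ⊔ τ') := by
  simp only [isingWeight, ← Real.exp_add]
  refine Real.exp_le_exp.2 ?_
  set σ := glue Λ τ bc with hσ
  set σ' := glue Λ τ' bc with hσ'
  rw [glue_inf, glue_sup]
  -- interactions are supermodular (field `h` for both), the extra field `(h' − h)·m` is increasing
  have hsm := neg_isingHamiltonian_supermodular G Λ h bc σ σ'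
  have hm : ∑ x ∈ Λ, spinAt x σ' ≤ ∑ x ∈ Λ, spinAt x (σ ⊔ σ') :=
    Finset.sum_le_sum fun x _ => spinAt_mono x le_sup_right
  have e : ∀ ρ : SpinConfig V, isingHamiltonian G Λ h' bc ρ = isingHamiltonian G Λ h bc ρ - (h' - h) * ∑ x ∈ Λ, spinAt x ρ := by
    intro ρ; simp only [isingHamiltonian]; ring
  rw [e, e]
  have hd : 0 ≤ h' - h := sub_nonneg.2 hh
  nlinarith [mul_le_mul_of_nonneg_left hsm hβ, mul_le_mul_of_nonneg_left hm (mul_nonneg hβ hd)]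

open scoped FinsetFamily in
/-- **The cross box condition for finite-volume Ising measures at fields `h ≤ h'`** (same boundary condition,
`β ≥ 0`): `μ_h[a,b] μ_{h'}[a',b'] ≤ μ_h[a ∧ a', b ∧ b'] μ_{h'}[a ∨ a', b ∨ b']`. [this work] -/
theorem crossBox_isingMeasure_field [Countable V] (Λ : Finset V) {β : ℝ} (hβ : 0 ≤ β) {h h' : ℝ} (hh : h ≤ h')
    (bc : BoundaryCondition V) (a b a' b' : V → ℤˣ) :
    isingMeasure G Λ β h bc (Icc a b) * isingMeasure G Λ β h' bc (Icc a' b') ≤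
      isingMeasure G Λ β h bc (Icc (a ⊓ a') (b ⊓ b')) * isingMeasure G Λ β h' bc (Icc (a ⊔ a') (b ⊔ b')) := by
  classical
  set w₁ : (Λ → ℤˣ) → ℝ := isingWeight G Λ β h bc with hw₁
  set w₂ : (Λ → ℤˣ) → ℝ := isingWeight G Λ β h' bc with hw₂
  set Z₁ : ℝ := isingPartitionFunction G Λ β h bc with hZ₁
  set Z₂ : ℝ := isingPartitionFunction G Λ β h' bc with hZ₂
  have hZ₁pos : 0 < Z₁ := isingPartitionFunction_pos G Λ β h _
  have hZ₂pos : 0 < Z₂ := isingPartitionFunction_pos G Λ β h' _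
  have hw₁0 : 0 ≤ w₁ := fun τ => (isingWeight_pos G Λ β h _ τ).le
  have hw₂0 : 0 ≤ w₂ := fun τ => (isingWeight_pos G Λ β h' _ τ).le
  set S : (V → ℤˣ) → (V → ℤˣ) → Finset (Λ → ℤˣ) :=
    fun p q => Finset.univ.filter fun τ => glue Λ τ bc ∈ Icc p q with hS
  have happ₁ : ∀ p q : V → ℤˣ, isingMeasure G Λ β h bc (Icc p q) =
      ENNReal.ofReal ((∑ τ ∈ S p q, w₁ τ) / Z₁) := fun p q => by
    rw [isingMeasure_apply_of_measurableSet G Λ β h _ (measurableSet_Icc_spinConfig p q)]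
  have happ₂ : ∀ p q : V → ℤˣ, isingMeasure G Λ β h' bc (Icc p q) =
      ENNReal.ofReal ((∑ τ ∈ S p q, w₂ τ) / Z₂) := fun p q => by
    rw [isingMeasure_apply_of_measurableSet G Λ β h' _ (measurableSet_Icc_spinConfig p q)]
  have hs₁ : ∀ p q : V → ℤˣ, 0 ≤ (∑ τ ∈ S p q, w₁ τ) / Z₁ := fun p q =>
    div_nonneg (Finset.sum_nonneg fun τ _ => hw₁0 τ) hZ₁pos.le
  rw [happ₁, happ₂, happ₁, happ₂, ← ENNReal.ofReal_mul (hs₁ _ _), ← ENNReal.ofReal_mul (hs₁ _ _)]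
  refine ENNReal.ofReal_le_ofReal ?_
  rw [div_mul_div_comm, div_mul_div_comm]
  refine div_le_div_of_nonneg_right ?_ (mul_pos hZ₁pos hZ₂pos).le
  have h4 := four_functions_theorem w₁ w₂ w₁ w₂ hw₁0 hw₂0 hw₁0 hw₂0
    (fun τ τ' => isingWeight_cross_condition_field G Λ hβ hh bc τ τ') (S a b) (S a' b')
  have hinfs : S a b ⊼ S a' b' ⊆ S (a ⊓ a') (b ⊓ b') := by
    intro c hc
    rw [Finset.mem_infs] at hc
    obtain ⟨τ, hτ, τ', hτ', rfl⟩ := hc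
    simp only [hS, Finset.mem_filter, Finset.mem_univ, true_and, mem_Icc] at hτ hτ' ⊢
    rw [glue_inf]
    exact ⟨le_inf (inf_le_left.trans hτ.1) (inf_le_right.trans hτ'.1), inf_le_inf hτ.2 hτ'.2⟩
  have hsups : S a b ⊻ S a' b' ⊆ S (a ⊔ a') (b ⊔ b') := by
    intro c hc
    rw [Finset.mem_sups] at hc
    obtain ⟨τ, hτ, τ', hτ', rfl⟩ := hc
    simp only [hS, Finset.mem_filter, Finset.mem_univ, true_and, mem_Icc] at hτ hτ' ⊢
    rw [glue_sup]
    exact ⟨sup_le_sup hτ.1 hτ'.1, sup_le (hτ.2.trans le_sup_left) (hτ'.2.trans le_sup_right)⟩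
  calc (∑ τ ∈ S a b, w₁ τ) * ∑ τ ∈ S a' b', w₂ τ
      ≤ (∑ τ ∈ S a b ⊼ S a' b', w₁ τ) * ∑ τ ∈ S a b ⊻ S a' b', w₂ τ := h4
    _ ≤ (∑ τ ∈ S (a ⊓ a') (b ⊓ b'), w₁ τ) * ∑ τ ∈ S (a ⊔ a') (b ⊔ b'), w₂ τ :=
        mul_le_mul (Finset.sum_le_sum_of_subset_of_nonneg hinfs fun τ _ _ => hw₁0 τ)
          (Finset.sum_le_sum_of_subset_of_nonneg hsups fun τ _ _ => hw₂0 τ)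
          (Finset.sum_nonneg fun τ _ => hw₂0 τ) (Finset.sum_nonneg fun τ _ => hw₁0 τ)

end Weights

/-! ### The cross box condition passes to local limits -/

section Closure

variable {ι : Type*} [Countable ι]

/-- **The cross box condition is closed under local convergence of two sequences** of finite measures on
`{−1,+1}^ι`. [this work] -/
theorem crossBox_of_tendsto_local₂ (μs νs : ℕ → Measure (ι → ℤˣ)) (μ ν : Measure (ι → ℤˣ))
    [∀ L, IsFiniteMeasure (μs L)] [∀ L, IsFiniteMeasure (νs L)] [IsFiniteMeasure μ] [IsFiniteMeasure ν]
    (hcross : ∀ L (a b a' b' : ι → ℤˣ), μs L (Icc a b) * νs L (Icc a' b') ≤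
      μs L (Icc (a ⊓ a') (b ⊓ b')) * νs L (Icc (a ⊔ a') (b ⊔ b')))
    (hconvμ : ∀ (J : Finset ι) (C : Set (ι → ℤˣ)), MeasurableSet C → DependsOn (fun σ => σ ∈ C) (↑J : Set ι) →
      Tendsto (fun L => μs L C) atTop (𝓝 (μ C)))
    (hconvν : ∀ (J : Finset ι) (C : Set (ι → ℤˣ)), MeasurableSet C → DependsOn (fun σ => σ ∈ C) (↑J : Set ι) →
      Tendsto (fun L => νs L C) atTop (𝓝 (ν C)))
    (a b a' b' : ι → ℤˣ) :
    μ (Icc a b) * ν (Icc a' b') ≤ μ (Icc (a ⊓ a') (b ⊓ b')) * ν (Icc (a ⊔ a') (b ⊔ b')) := by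
  classical
  obtain ⟨J, hJm, hJ⟩ := exists_finset_exhaustion (ι := ι)
  set F : ℕ → (ι → ℤˣ) → (ι → ℤˣ) → Set (ι → ℤˣ) :=
    fun m p q => Icc ((J m).piecewise p (-1)) ((J m).piecewise q 1) with hF
  have hFm : ∀ m p q, MeasurableSet (F m p q) := fun m p q => measurableSet_Icc_spinConfig _ _
  have hface : ∀ m, μ (F m a b) * ν (F m a' b') ≤ μ (F m (a ⊓ a') (b ⊓ b')) * ν (F m (a ⊔ a') (b ⊔ b')) := by
    intro m
    have hcμ : ∀ p q, Tendsto (fun L => μs L (F m p q)) atTop (𝓝 (μ (F m p q))) := fun p q =>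
      hconvμ (J m) _ (hFm m p q) (dependsOn_mem_Icc_piecewise (J m) p q)
    have hcν : ∀ p q, Tendsto (fun L => νs L (F m p q)) atTop (𝓝 (ν (F m p q))) := fun p q =>
      hconvν (J m) _ (hFm m p q) (dependsOn_mem_Icc_piecewise (J m) p q)
    refine le_of_tendsto_of_tendsto'
      (ENNReal.Tendsto.mul (hcμ a b) (Or.inr (measure_ne_top _ _)) (hcν a' b') (Or.inr (measure_ne_top _ _)))
      (ENNReal.Tendsto.mul (hcμ (a ⊓ a') (b ⊓ b')) (Or.inr (measure_ne_top _ _)) (hcν (a ⊔ a') (b ⊔ b'))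
        (Or.inr (measure_ne_top _ _))) fun L => ?_
    have key := hcross L ((J m).piecewise a (-1)) ((J m).piecewise b 1) ((J m).piecewise a' (-1))
      ((J m).piecewise b' 1)
    simp only [hF, piecewise_inf, piecewise_sup]
    exact key
  have hlim : ∀ (ρ : Measure (ι → ℤˣ)) [IsFiniteMeasure ρ] (p q : ι → ℤˣ),
      Tendsto (fun m => ρ (F m p q)) atTop (𝓝 (ρ (Icc p q))) := by
    intro ρ _ p q
    have h := tendsto_measure_iInter_atTop (μ := ρ) (fun m => (hFm m p q).nullMeasurableSet)
      (antitone_Icc_piecewise hJm p q) ⟨0, measure_ne_top _ _⟩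
    rw [iInter_Icc_piecewise hJ p q] at h
    exact h
  exact le_of_tendsto_of_tendsto'
    (ENNReal.Tendsto.mul (hlim μ a b) (Or.inr (measure_ne_top _ _)) (hlim ν a' b') (Or.inr (measure_ne_top _ _)))
    (ENNReal.Tendsto.mul (hlim μ (a ⊓ a') (b ⊓ b')) (Or.inr (measure_ne_top _ _)) (hlim ν (a ⊔ a') (b ⊔ b'))
      (Or.inr (measure_ne_top _ _))) fun m => hface m

/-- **Local limits of finite-volume Ising measures with ordered boundary conditions satisfy the cross box condition**
(any countable locally finite graph, any volumes `Λ_L`, boundary conditions `η_L ≤ η'_L`, `β ≥ 0`, any `h`).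
[this work] -/
theorem crossBox_of_tendsto_isingMeasure_fixed {V : Type*} (G : SimpleGraph V) [DecidableEq V] [G.LocallyFinite]
    [Countable V] (Λs : ℕ → Finset V) {ηs ηs' : ℕ → SpinConfig V} (hη : ∀ L, ηs L ≤ ηs' L) {β : ℝ} (hβ : 0 ≤ β)
    (h : ℝ) (μ μ' : Measure (V → ℤˣ)) [IsFiniteMeasure μ] [IsFiniteMeasure μ']
    (hconv : ∀ (J : Finset V) (C : Set (V → ℤˣ)), MeasurableSet C → DependsOn (fun σ => σ ∈ C) (↑J : Set V) →
      Tendsto (fun L => isingMeasure G (Λs L) β h (.fixed (ηs L)) C) atTop (𝓝 (μ C)))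
    (hconv' : ∀ (J : Finset V) (C : Set (V → ℤˣ)), MeasurableSet C → DependsOn (fun σ => σ ∈ C) (↑J : Set V) →
      Tendsto (fun L => isingMeasure G (Λs L) β h (.fixed (ηs' L)) C) atTop (𝓝 (μ' C)))
    (a b a' b' : V → ℤˣ) :
    μ (Icc a b) * μ' (Icc a' b') ≤ μ (Icc (a ⊓ a') (b ⊓ b')) * μ' (Icc (a ⊔ a') (b ⊔ b')) :=
  crossBox_of_tendsto_local₂ (fun L => isingMeasure G (Λs L) β h (.fixed (ηs L)))
    (fun L => isingMeasure G (Λs L) β h (.fixed (ηs' L))) μ μ'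
    (fun L p q p' q' => crossBox_isingMeasure_fixed G (Λs L) hβ h (hη L) p q p' q') hconv hconv' a b a' b'

/-- **Hence such limits are stochastically ordered for ALL bounded measurable increasing functionals**:
`∫ f dμ ≤ ∫ f dμ'` (probability measures). [this work] -/
theorem integral_le_of_tendsto_isingMeasure_fixed {V : Type*} (G : SimpleGraph V) [DecidableEq V]
    [G.LocallyFinite] [Countable V] (Λs : ℕ → Finset V) {ηs ηs' : ℕ → SpinConfig V} (hη : ∀ L, ηs L ≤ ηs' L)
    {β : ℝ} (hβ : 0 ≤ β) (h : ℝ) (μ μ' : Measure (V → ℤˣ)) [IsProbabilityMeasure μ] [IsProbabilityMeasure μ']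
    (hconv : ∀ (J : Finset V) (C : Set (V → ℤˣ)), MeasurableSet C → DependsOn (fun σ => σ ∈ C) (↑J : Set V) →
      Tendsto (fun L => isingMeasure G (Λs L) β h (.fixed (ηs L)) C) atTop (𝓝 (μ C)))
    (hconv' : ∀ (J : Finset V) (C : Set (V → ℤˣ)), MeasurableSet C → DependsOn (fun σ => σ ∈ C) (↑J : Set V) →
      Tendsto (fun L => isingMeasure G (Λs L) β h (.fixed (ηs' L)) C) atTop (𝓝 (μ' C)))
    {f : (V → ℤˣ) → ℝ} (hf : Monotone f) (hfm : Measurable f) {C : ℝ} (hfC : ∀ x, |f x| ≤ C) :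
    ∫ x, f x ∂μ ≤ ∫ x, f x ∂μ' :=
  holley_of_crossBox_spin μ μ' (crossBox_of_tendsto_isingMeasure_fixed G Λs hη hβ h μ μ' hconv hconv') hf hfm hfC

end Closure

/-! ### The minus and plus states of `ℤ^d` -/

section States

variable {d : ℕ} {β h : ℝ}

/-- **The infinite-volume minus and plus states satisfy the cross box condition** (`β ≥ 0`, any `h`): for every
probability measures `μ⁻`, `μ⁺` on `{−1,+1}^{ℤ^d}` with the minus resp. plus correlations,
`μ⁻[a,b] μ⁺[a',b'] ≤ μ⁻[a ∧ a', b ∧ b'] μ⁺[a ∨ a', b ∨ b']` for all order boxes. [this work] -/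
theorem crossBox_minus_plus (hβ : 0 ≤ β) (μm μp : Measure (SpinConfig (Site d))) [IsProbabilityMeasure μm]
    [IsProbabilityMeasure μp] (hμm : ∀ B : Finset (Site d), spinCorr μm B = minusCorr d β h B)
    (hμp : ∀ B : Finset (Site d), spinCorr μp B = plusCorr d β h B) (a b a' b' : SpinConfig (Site d)) :
    μm (Icc a b) * μp (Icc a' b') ≤ μm (Icc (a ⊓ a') (b ⊓ b')) * μp (Icc (a ⊔ a') (b ⊔ b')) := by
  classical
  refine crossBox_of_tendsto_local₂ (fun L => isingMeasure (zdGraph d) (box d L) β h .minus)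
    (fun L => isingMeasure (zdGraph d) (box d L) β h .plus) μm μp (fun L p q p' q' => ?_)
    (fun J C hCm hC => tendsto_isingMeasure_box_of_forall_spinCorr .minus (tendsto_isingCorr_minus_box hβ h) μm hμm
      J hCm hC)
    (fun J C hCm hC => tendsto_isingMeasure_box_of_forall_spinCorr .plus (tendsto_isingCorr_plus_box hβ h) μp hμp
      J hCm hC) a b a' b'
  exact crossBox_isingMeasure_fixed (zdGraph d) (box d L) hβ h (η := (-1 : SpinConfig (Site d)))
    (η' := (1 : SpinConfig (Site d))) (fun x => neg_one_le_intUnits _) p q p' q'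

/-- **`μ⁻ ≤ μ⁺` on every local increasing event** (`β ≥ 0`, any `h`): `μ⁻(U) ≤ μ⁺(U)` for every measurable
increasing event depending on finitely many spins. [this work] -/
theorem minusState_le_plusState_upperSet_local (hβ : 0 ≤ β) (μm μp : Measure (SpinConfig (Site d)))
    [IsProbabilityMeasure μm] [IsProbabilityMeasure μp]
    (hμm : ∀ B : Finset (Site d), spinCorr μm B = minusCorr d β h B)
    (hμp : ∀ B : Finset (Site d), spinCorr μp B = plusCorr d β h B) (J : Finset (Site d))
    {U : Set (SpinConfig (Site d))} (hU : IsUpperSet U) (hUm : MeasurableSet U)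
    (hUd : DependsOn (fun σ => σ ∈ U) (↑J : Set (Site d))) : μm U ≤ μp U := by
  simpa only [measure_univ, mul_one, one_mul] using
    holley_local_upperSet_of_crossBox_spin μm μp (crossBox_minus_plus hβ μm μp hμm hμp) J hU hUm hUd

/-- **`μ⁻ ≤ μ⁺` on every bounded increasing local functional**: `∫ f dμ⁻ ≤ ∫ f dμ⁺`. [this work] -/
theorem minusState_le_plusState_local (hβ : 0 ≤ β) (μm μp : Measure (SpinConfig (Site d)))
    [IsProbabilityMeasure μm] [IsProbabilityMeasure μp]
    (hμm : ∀ B : Finset (Site d), spinCorr μm B = minusCorr d β h B)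
    (hμp : ∀ B : Finset (Site d), spinCorr μp B = plusCorr d β h B) (J : Finset (Site d))
    {f : SpinConfig (Site d) → ℝ} (hf : Monotone f) (hfd : DependsOn f (↑J : Set (Site d))) {C : ℝ}
    (hfC : ∀ x, |f x| ≤ C) : ∫ x, f x ∂μm ≤ ∫ x, f x ∂μp :=
  holley_local_of_crossBox_spin μm μp (crossBox_minus_plus hβ μm μp hμm hμp) J hf hfd hfC

/-- **`μ⁻ ≤ μ⁺` ON EVERY MEASURABLE INCREASING EVENT of the infinite configuration** (`β ≥ 0`, any `h`; tail events
included): `μ⁻(U) ≤ μ⁺(U)`. [this work] -/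
theorem minusState_le_plusState_upperSet (hβ : 0 ≤ β) (μm μp : Measure (SpinConfig (Site d)))
    [IsProbabilityMeasure μm] [IsProbabilityMeasure μp]
    (hμm : ∀ B : Finset (Site d), spinCorr μm B = minusCorr d β h B)
    (hμp : ∀ B : Finset (Site d), spinCorr μp B = plusCorr d β h B) {U : Set (SpinConfig (Site d))}
    (hU : IsUpperSet U) (hUm : MeasurableSet U) : μm U ≤ μp U := by
  simpa only [measure_univ, mul_one, one_mul] using
    holley_upperSet_of_crossBox_spin μm μp (crossBox_minus_plus hβ μm μp hμm hμp) hU hUm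

/-- **`μ⁻ ≤_st μ⁺` FOR ALL BOUNDED MEASURABLE INCREASING FUNCTIONALS of the infinite configuration**:
`∫ f dμ⁻ ≤ ∫ f dμ⁺`. [this work] -/
theorem minusState_le_plusState (hβ : 0 ≤ β) (μm μp : Measure (SpinConfig (Site d))) [IsProbabilityMeasure μm]
    [IsProbabilityMeasure μp] (hμm : ∀ B : Finset (Site d), spinCorr μm B = minusCorr d β h B)
    (hμp : ∀ B : Finset (Site d), spinCorr μp B = plusCorr d β h B) {f : SpinConfig (Site d) → ℝ}
    (hf : Monotone f) (hfm : Measurable f) {C : ℝ} (hfC : ∀ x, |f x| ≤ C) : ∫ x, f x ∂μm ≤ ∫ x, f x ∂μp :=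
  holley_of_crossBox_spin μm μp (crossBox_minus_plus hβ μm μp hμm hμp) hf hfm hfC

/-- **The plus states at fields `h ≤ h'` satisfy the cross box condition** (`β ≥ 0`). [this work] -/
theorem crossBox_plus_field (hβ : 0 ≤ β) {h' : ℝ} (hh : h ≤ h') (μ μ' : Measure (SpinConfig (Site d)))
    [IsProbabilityMeasure μ] [IsProbabilityMeasure μ'] (hμ : ∀ B : Finset (Site d), spinCorr μ B = plusCorr d β h B)
    (hμ' : ∀ B : Finset (Site d), spinCorr μ' B = plusCorr d β h' B) (a b a' b' : SpinConfig (Site d)) :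
    μ (Icc a b) * μ' (Icc a' b') ≤ μ (Icc (a ⊓ a') (b ⊓ b')) * μ' (Icc (a ⊔ a') (b ⊔ b')) := by
  classical
  exact crossBox_of_tendsto_local₂ (fun L => isingMeasure (zdGraph d) (box d L) β h .plus)
    (fun L => isingMeasure (zdGraph d) (box d L) β h' .plus) μ μ'
    (fun L p q p' q' => crossBox_isingMeasure_field (zdGraph d) (box d L) hβ hh .plus p q p' q')
    (fun J C hCm hC => tendsto_isingMeasure_box_of_forall_spinCorr .plus (tendsto_isingCorr_plus_box hβ h) μ hμ
      J hCm hC)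
    (fun J C hCm hC => tendsto_isingMeasure_box_of_forall_spinCorr .plus (tendsto_isingCorr_plus_box hβ h') μ' hμ'
      J hCm hC) a b a' b'

/-- **THE PLUS STATE IS STOCHASTICALLY INCREASING IN THE FIELD**, for all bounded measurable increasing functionals
of the infinite configuration: `h ≤ h' ⇒ ∫ f dμ⁺_{β,h} ≤ ∫ f dμ⁺_{β,h'}` (`β ≥ 0`). [this work] -/
theorem plusState_mono_field (hβ : 0 ≤ β) {h' : ℝ} (hh : h ≤ h') (μ μ' : Measure (SpinConfig (Site d)))
    [IsProbabilityMeasure μ] [IsProbabilityMeasure μ'] (hμ : ∀ B : Finset (Site d), spinCorr μ B = plusCorr d β h B)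
    (hμ' : ∀ B : Finset (Site d), spinCorr μ' B = plusCorr d β h' B) {f : SpinConfig (Site d) → ℝ} (hf : Monotone f)
    (hfm : Measurable f) {C : ℝ} (hfC : ∀ x, |f x| ≤ C) : ∫ x, f x ∂μ ≤ ∫ x, f x ∂μ' :=
  holley_of_crossBox_spin μ μ' (crossBox_plus_field hβ hh μ μ' hμ hμ') hf hfm hfC

/-- The plus state is increasing in the field on every measurable increasing event. [this work] -/
theorem plusState_mono_field_upperSet (hβ : 0 ≤ β) {h' : ℝ} (hh : h ≤ h') (μ μ' : Measure (SpinConfig (Site d)))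
    [IsProbabilityMeasure μ] [IsProbabilityMeasure μ'] (hμ : ∀ B : Finset (Site d), spinCorr μ B = plusCorr d β h B)
    (hμ' : ∀ B : Finset (Site d), spinCorr μ' B = plusCorr d β h' B) {U : Set (SpinConfig (Site d))}
    (hU : IsUpperSet U) (hUm : MeasurableSet U) : μ U ≤ μ' U := by
  simpa only [measure_univ, mul_one, one_mul] using
    holley_upperSet_of_crossBox_spin μ μ' (crossBox_plus_field hβ hh μ μ' hμ hμ') hU hUm

end States

end Summit.CriticalPhenomena.PercolationContinuityZ3.Theorems.SahiBoxTP2
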